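import Summits.RiemannHypothesis.RiemannHypothesis.Theses.WeilComb
import Mathlib.Analysis.SpecialFunctions.Log.Basic
import Mathlib.Analysis.SpecialFunctions.Exp
import Mathlib.Analysis.Complex.ExponentialBounds
import Mathlib.Analysis.Real.Pi.Bounds

/-!
# Stub `stub_assemble20` of line `Sketch` for crux `WeilComb.CombShapePositivity`
(item stmt-RiemannHypothesis-11229, route route-RiemannHypothesis-WeilComb)

The pure real-arithmetic budget of the effective subcritical window `εM ≤ 1/20` for the fixed-shape comb
(skeleton v7.4, `Cruxes/CombShapePositivity/Lines/Sketch.lean`, theorem `stub_windowSub20`), using the two inputs landed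
after `stub_assemble40`/`assemble_inv25`: the certified bump ratio `I₀² ≤ (8/5)N` (`stub_bumpRatio`, p115104) and the
elementary Helson constant `3/20` (`helsonPotential_le_three_twentieths`, p113016). All analysis is in
the four landed stubs `stub_offdiagSchur` (p109602), `stub_poincareEta` (p109896), `stub_archBathtub` (p110455),
`stub_helsonG` (p110888); here only real numbers occur.

Notation (all real variables): `ε` the width, `Mr = M`, `λ = εMr ≤ 1/20`; `N = ‖φ₀‖₂²`, `I = ∫φ₀` (`I² ≤ (8/5)N`);
`L = Σ‖a_m‖²`, `D` the Dirichlet energy, `Qp = Σ m log m ‖a_m‖²`, `Q1 = Σ m‖a_m‖²`, `V` the Helson potential,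
`H = V − D` the Helson form, `ReQ = Re Q(g)`, `ReP` the polar term, `Wd = Re W_∞(ψ_ε)` (diagonal archimedean
symbol), `Off` the off-diagonal archimedean form, `F0, F1 = |φ̂_ε(0)|, |φ̂_ε(1)|`, `nAm, nAp = ‖A₋‖, ‖A₊‖`.

**Budget** (per unit `ε⁻¹N`, with `E = e^ε ≤ 1.0525`, `κ = (1 − (e^{4ε}−1)Mr/2)⁻¹ ≤ 1.1364`, `A = 1 + log Mr`,
`X = εAQ1 ≤ εQp + λL ≤ 6λD + (119/50)λL` by the Poincaré inequality at `η = 5`, pole split `θ = 8/5`):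
`ReQ/(ε⁻¹N) ≥ D[1 − E(1 + (8/5)κ)·6λ] + L[log(25/4) − 23/20 − (64/25)Eλ − E(1 + (8/5)κ)(119/50)λ − 2.15ε] ≥ 0.11 D + 0.08 L ≥ 0`,
using the diagonal `log(ε⁻¹N/(2I²)) ≥ log(1/ε) − log(16/5) ≥ log Mr + log 20 − log(16/5)`, the Helson constant `3/20`,
the pole `2‖A₋‖‖A₊‖ ≤ (8/5)MrL + (5/8)AQ1` (AM–GM on `‖A₋‖² ≤ AL`, `‖A₊‖² ≤ MrQ1`) with `F0F1 ≤ e^ε I²`, the bathtub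
lower-order term `(21/(5π)) I² ≤ 2.15 N`, and `I² ≤ (8/5)N` in every negative term.
-/

noncomputable section

-- the sub-problem path `RiemannHypothesis/RiemannHypothesis` (single-conjunct summit, D-0017) duplicates a namespace
set_option linter.dupNamespace false

namespace Summit.RiemannHypothesis.RiemannHypothesis.Theorems.WeilCombBohrFejer

/-- `log(25/4) ≥ 1.8318` (from `2^65 ≤ 25^14`, i.e. `2^37 ≤ (25/4)^14`, and `log 2 > 0.6931471803`). [folklore] -/
private theorem log_twentyfive_fourths_ge_assemble20 : (1.8318 : ℝ) ≤ Real.log (25 / 4) := by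
  have h2 := Real.log_two_gt_d9
  have hpow : ((2 : ℝ)) ^ 65 ≤ (25 : ℝ) ^ 14 := by norm_num
  have hlog : Real.log ((2 : ℝ) ^ 65) ≤ Real.log ((25 : ℝ) ^ 14) :=
    Real.log_le_log (by positivity) hpow
  rw [Real.log_pow, Real.log_pow] at hlog
  push_cast at hlog
  have h4 : Real.log 4 = 2 * Real.log 2 := by
    rw [show (4 : ℝ) = 2 ^ 2 by norm_num, Real.log_pow]; norm_num
  rw [Real.log_div (by norm_num) (by norm_num), h4]
  linarith

/-- `e^x ≤ 1 + x + x²` for `0 ≤ x ≤ 1`. [folklore] -/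
private theorem exp_le_quad_assemble20 {x : ℝ} (hx0 : 0 ≤ x) (hx1 : x ≤ 1) :
    Real.exp x ≤ 1 + x + x ^ 2 := by
  have h0 : |x| ≤ 1 := by rw [abs_of_nonneg hx0]; exact hx1
  have h' := (abs_le.1 (Real.abs_exp_sub_one_sub_id_le h0)).2
  linarith

/-- AM–GM for the pole with split `θ = 8/5`: from `‖A₋‖² ≤ A L`, `‖A₊‖² ≤ Mr Q1`,
`2‖A₋‖‖A₊‖ ≤ (8/5) Mr L + (5/8) A Q1`. [folklore] -/
private theorem pole_amgm_assemble20 {Mr A L Q1 nAm nAp : ℝ} (hMr0 : 0 < Mr) (hA0 : 0 < A)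
    (hnAm2 : nAm ^ 2 ≤ A * L) (hnAp2 : nAp ^ 2 ≤ Mr * Q1) :
    2 * (nAm * nAp) ≤ 8 / 5 * Mr * L + 5 / 8 * (A * Q1) := by
  have hsq : 0 ≤ (8 / 5 * Mr * nAm - A * nAp) ^ 2 := sq_nonneg _
  have esq : (8 / 5 * Mr * nAm - A * nAp) ^ 2 =
      64 / 25 * Mr ^ 2 * nAm ^ 2 - 16 / 5 * Mr * A * (nAm * nAp) + A ^ 2 * nAp ^ 2 := by ring
  have hk : 16 / 5 * Mr * A * (nAm * nAp) ≤ 64 / 25 * Mr ^ 2 * nAm ^ 2 + A ^ 2 * nAp ^ 2 := by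
    rw [esq] at hsq; linarith only [hsq]
  have hk1 : 64 / 25 * Mr ^ 2 * nAm ^ 2 ≤ 64 / 25 * Mr ^ 2 * (A * L) :=
    mul_le_mul_of_nonneg_left hnAm2 (by positivity)
  have hk2 : A ^ 2 * nAp ^ 2 ≤ A ^ 2 * (Mr * Q1) := mul_le_mul_of_nonneg_left hnAp2 (by positivity)
  have e3 : (Mr * A) * (64 / 25 * Mr * L + A * Q1) = 64 / 25 * Mr ^ 2 * (A * L) + A ^ 2 * (Mr * Q1) := by ring
  have e4 : (Mr * A) * (16 / 5 * (nAm * nAp)) = 16 / 5 * Mr * A * (nAm * nAp) := by ring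
  have hMA : 0 < Mr * A := mul_pos hMr0 hA0
  have hk4 : (Mr * A) * (16 / 5 * (nAm * nAp)) ≤ (Mr * A) * (64 / 25 * Mr * L + A * Q1) := by
    rw [e3, e4]; linarith only [hk, hk1, hk2]
  have hk5 := le_of_mul_le_mul_left hk4 hMA
  linarith only [hk5]

/-- The diagonal comparison `log(ε⁻¹N/(2I²)) ≥ log Mr + log(25/4)` for `εMr ≤ 1/20`, `I² ≤ (8/5)N`
(`ε⁻¹N/(2I²) ≥ 20 Mr · 5/16 = (25/4) Mr`). [folklore] -/
private theorem diag_log_assemble20 {ε Mr N I : ℝ} (hε : 0 < ε) (hMr0 : 0 < Mr) (hlam : ε * Mr ≤ 1 / 20)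
    (hN : 0 < N) (hI : 0 < I) (hI2 : I ^ 2 ≤ 8 / 5 * N) :
    Real.log Mr + Real.log (25 / 4) ≤ Real.log (ε⁻¹ * N / (2 * I ^ 2)) := by
  have hI2pos : 0 < 2 * I ^ 2 := by positivity
  have hinv : 20 * Mr ≤ ε⁻¹ := by
    rw [le_inv_comm₀ (by positivity) hε]
    have : ε * (20 * Mr) ≤ 1 := by linarith only [hlam]
    calc ε = ε * (20 * Mr) * (20 * Mr)⁻¹ := by field_simp
      _ ≤ 1 * (20 * Mr)⁻¹ := mul_le_mul_of_nonneg_right this (by positivity)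
      _ = (20 * Mr)⁻¹ := one_mul _
  have hq : 25 / 4 * Mr ≤ ε⁻¹ * N / (2 * I ^ 2) := by
    rw [le_div_iff₀ hI2pos]
    have h1 : 25 / 4 * Mr * (2 * I ^ 2) ≤ 25 / 4 * Mr * (16 / 5 * N) :=
      mul_le_mul_of_nonneg_left (by linarith only [hI2]) (by positivity)
    have h2 : 20 * Mr * N ≤ ε⁻¹ * N := mul_le_mul_of_nonneg_right hinv hN.le
    have e : 25 / 4 * Mr * (16 / 5 * N) = 20 * Mr * N := by ring
    linarith only [h1, h2, e]
  have hlog := Real.log_le_log (by positivity) hq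
  rw [Real.log_mul (by norm_num) hMr0.ne'] at hlog
  linarith only [hlog]

/-- The lower-order term of the bathtub bound for `φ_ε` with the certified ratio: `(21/(5π)) I² ≤ 2.15 N`
(`I² ≤ (8/5)N`, `π > 3.14`). [folklore] -/
private theorem junk_le_assemble20 {N I : ℝ} (hN : 0 < N) (hI2 : I ^ 2 ≤ 8 / 5 * N) :
    21 / (5 * Real.pi) * I ^ 2 ≤ 2.15 * N := by
  have hπ : (3.14 : ℝ) < Real.pi := Real.pi_gt_d2
  have h1 : 21 / (5 * Real.pi) ≤ 1.3376 := by
    rw [div_le_iff₀ (by positivity)]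
    linarith only [hπ]
  have h2 : 21 / (5 * Real.pi) * I ^ 2 ≤ 1.3376 * I ^ 2 := mul_le_mul_of_nonneg_right h1 (sq_nonneg _)
  linarith only [h2, hI2, hN]

/-- **Stub S5'' — the budget of the effective window `εM ≤ 1/20` (pure real arithmetic).**
Per unit `ε⁻¹N`: diagonal `log(1/ε) − 1 − log(2I²/N) ≥ log M + log 20 − 1 − log(16/5)`, Helson `−(log M + 3/20)`,
pole `≤ e^{ε}(I²/N)((8/5)λL + (5/8)X)`, off-diagonal `≤ (I²/N)e^{ε}(1 − (e^{4ε}−1)M/2)⁻¹ X` with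
`X = ε(1 + log M)Q₁ ≤ εQ' + λL ≤ (1+η)λD + ((1+1/η)(23/20) + 1)λL` (`η = 5`, `λ = εM ≤ 1/20`, `I² ≤ (8/5)N`):
`log 20 = 3.00 > 1 + log(16/5) + 3/20 + 11.9/20 + O(ε)`. -/
theorem stub_assemble20 : ∀ {ε Mr N I L D Qp Q1 V H ReQ ReP Wd Off F0 F1 nAm nAp : ℝ},
    0 < ε → 1 ≤ Mr → ε * Mr ≤ 1 / 20 →
    0 < N → 0 < I → I ^ 2 ≤ 8 / 5 * N →
    0 ≤ L → 0 ≤ D → 0 ≤ Qp → 0 ≤ Q1 →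
    (Real.log Mr + 1) * Q1 ≤ Qp + Mr * L →
    (∀ η : ℝ, 0 < η → Qp ≤ (1 + η) * Mr * D + (1 + 1 / η) * (23 / 20) * Mr * L) →
    V ≤ (Real.log Mr + 3 / 20) * L → H = V - D →
    ReQ = ReP - ε⁻¹ * N * H + (L * Wd + Off) →
    0 ≤ F0 → 0 ≤ F1 → F0 ≤ Real.exp (ε / 2) * I → F1 ≤ Real.exp (ε / 2) * I →
    0 ≤ nAm → 0 ≤ nAp → nAm ^ 2 ≤ (1 + Real.log Mr) * L → nAp ^ 2 ≤ Mr * Q1 →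
    -(2 * (F0 * F1 * (nAm * nAp))) ≤ ReP →
    ε⁻¹ * N * (Real.log (ε⁻¹ * N / (2 * I ^ 2)) - 1) - 21 / (5 * Real.pi) * I ^ 2 ≤ Wd →
    -(I ^ 2 * Real.exp ε * (1 - (Real.exp (4 * ε) - 1) * Mr / 2)⁻¹ * (1 + Real.log Mr) * Q1) ≤ Off →
    0 ≤ ReQ := by
  intro ε Mr N I L D Qp Q1 V H ReQ ReP Wd Off F0 F1 nAm nAp hε hM hlam hN hI hI2 hL hD hQp hQ1 hQ1le hPoinc
    hV hH hQ hF0 hF1 hF0le hF1le hnAm hnAp hnAm2 hnAp2 hP hWd hOff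
  -- elementary constants
  have hlog254 := log_twentyfive_fourths_ge_assemble20
  have hMr0 : 0 < Mr := by linarith only [hM]
  have hε40 : ε ≤ 1 / 20 := by
    have : ε * 1 ≤ ε * Mr := mul_le_mul_of_nonneg_left hM hε.le
    linarith only [this, hlam]
  have hlam0 : 0 ≤ ε * Mr := by positivity
  -- `E = e^ε`
  set E : ℝ := Real.exp ε with hE
  have hEpos : 0 < E := Real.exp_pos ε
  have hEle : E ≤ 1.0525 := by
    have h := exp_le_quad_assemble20 hε.le (by linarith only [hε40])
    have hε2 : ε ^ 2 ≤ (1 / 20) ^ 2 := pow_le_pow_left₀ hε.le hε40 2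
    rw [hE]
    linarith only [h, hε2, hε40, hε]
  -- `t = (e^{4ε} − 1) Mr / 2 ∈ [0, 0.12]`, `κ = (1 − t)⁻¹ ∈ (0, 1.1364]`
  set t : ℝ := (Real.exp (4 * ε) - 1) * Mr / 2 with ht
  have ht0 : 0 ≤ t := by
    have : 1 ≤ Real.exp (4 * ε) := Real.one_le_exp (by positivity)
    rw [ht]
    have : 0 ≤ (Real.exp (4 * ε) - 1) * Mr := mul_nonneg (by linarith only [this]) hMr0.le
    linarith only [this]
  have htle : t ≤ 0.12 := by
    have h := exp_le_quad_assemble20 (x := 4 * ε) (by positivity) (by linarith only [hε40])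
    have h1 : (Real.exp (4 * ε) - 1) * Mr ≤ (4 * ε + (4 * ε) ^ 2) * Mr :=
      mul_le_mul_of_nonneg_right (by linarith only [h]) hMr0.le
    have h2 : (4 * ε + (4 * ε) ^ 2) * Mr = 4 * (ε * Mr) + 16 * ε * (ε * Mr) := by ring
    have h3 : 16 * ε * (ε * Mr) ≤ 16 * (1 / 20) * (1 / 20) := by
      have := mul_le_mul hε40 hlam (by positivity) (by norm_num : (0 : ℝ) ≤ 1 / 20)
      linarith only [this]
    rw [ht]
    linarith only [h1, h2, h3, hlam]
  set κ : ℝ := (1 - t)⁻¹ with hκ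
  have h1t : 0.88 ≤ 1 - t := by linarith only [htle]
  have hκpos : 0 < κ := by rw [hκ]; exact inv_pos.2 (by linarith only [h1t])
  have hκle : κ ≤ 1.1364 := by
    rw [hκ, inv_le_comm₀ (by linarith only [h1t]) (by norm_num)]
    linarith only [h1t]
  have hκexpr : (1 - (Real.exp (4 * ε) - 1) * Mr / 2)⁻¹ = κ := by rw [hκ, ht]
  -- `A = 1 + log Mr ≥ 1`
  set A : ℝ := 1 + Real.log Mr with hA
  have hlogMr : 0 ≤ Real.log Mr := Real.log_nonneg hM
  have hA1 : 1 ≤ A := by rw [hA]; linarith only [hlogMr]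
  have hA0 : 0 < A := by linarith only [hA1]
  -- the pole: `2 nAm nAp ≤ (8/5) Mr L + (5/8) A Q1` and `F0 F1 ≤ E I²`
  have hpole : 2 * (nAm * nAp) ≤ 8 / 5 * Mr * L + 5 / 8 * (A * Q1) :=
    pole_amgm_assemble20 hMr0 hA0 (by rw [hA]; exact hnAm2) hnAp2
  have hFF : F0 * F1 ≤ E * I ^ 2 := by
    have hI0 : 0 ≤ Real.exp (ε / 2) * I := by positivity
    calc F0 * F1 ≤ (Real.exp (ε / 2) * I) * (Real.exp (ε / 2) * I) := mul_le_mul hF0le hF1le hF1 hI0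
      _ = (Real.exp (ε / 2) * Real.exp (ε / 2)) * I ^ 2 := by ring
      _ = E * I ^ 2 := by rw [← Real.exp_add, show ε / 2 + ε / 2 = ε by ring]
  have hP' : -(E * I ^ 2 * (8 / 5 * Mr * L + 5 / 8 * (A * Q1))) ≤ ReP := by
    have hnn : 0 ≤ nAm * nAp := mul_nonneg hnAm hnAp
    have h1 : F0 * F1 * (nAm * nAp) ≤ E * I ^ 2 * (nAm * nAp) := mul_le_mul_of_nonneg_right hFF hnn
    have h2 : E * I ^ 2 * (2 * (nAm * nAp)) ≤ E * I ^ 2 * (8 / 5 * Mr * L + 5 / 8 * (A * Q1)) :=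
      mul_le_mul_of_nonneg_left hpole (by positivity)
    linarith only [hP, h1, h2]
  -- the diagonal: `log(ε⁻¹N/(2I²)) ≥ log Mr + log(25/4)`, and the lower-order term
  have hdiag : Real.log Mr + Real.log (25 / 4) ≤ Real.log (ε⁻¹ * N / (2 * I ^ 2)) :=
    diag_log_assemble20 hε hMr0 hlam hN hI hI2
  have hjunk : 21 / (5 * Real.pi) * I ^ 2 ≤ 2.15 * N := junk_le_assemble20 hN hI2
  -- `Wd` per unit
  have hWd' : ε⁻¹ * N * (Real.log Mr + Real.log (25 / 4) - 1) - 2.15 * N ≤ Wd := by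
    have h1 : ε⁻¹ * N * (Real.log Mr + Real.log (25 / 4) - 1) ≤
        ε⁻¹ * N * (Real.log (ε⁻¹ * N / (2 * I ^ 2)) - 1) :=
      mul_le_mul_of_nonneg_left (by linarith only [hdiag]) (by positivity)
    linarith only [h1, hWd, hjunk]
  -- replace `I²` by `(8/5)N` in the negative terms
  have hP'' : -(8 / 5 * E * N * (8 / 5 * Mr * L + 5 / 8 * (A * Q1))) ≤ ReP := by
    have h0 : 0 ≤ E * (8 / 5 * Mr * L + 5 / 8 * (A * Q1)) := by positivity
    have h1 : E * I ^ 2 * (8 / 5 * Mr * L + 5 / 8 * (A * Q1)) ≤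
        E * (8 / 5 * N) * (8 / 5 * Mr * L + 5 / 8 * (A * Q1)) := by
      have := mul_le_mul_of_nonneg_left hI2 h0
      linarith only [this]
    linarith only [hP', h1]
  have hOff' : -(8 / 5 * N * E * κ * A * Q1) ≤ Off := by
    have h0 : 0 ≤ E * κ * A * Q1 := by positivity
    have h1 : I ^ 2 * (E * κ * A * Q1) ≤ 8 / 5 * N * (E * κ * A * Q1) := mul_le_mul_of_nonneg_right hI2 h0
    have e1 : I ^ 2 * E * κ * A * Q1 = I ^ 2 * (E * κ * A * Q1) := by ring
    have e2 : 8 / 5 * N * E * κ * A * Q1 = 8 / 5 * N * (E * κ * A * Q1) := by ring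
    rw [e1] at hOff
    rw [e2]
    linarith only [hOff, h1]
  -- the Helson form
  have hNε : 0 < ε⁻¹ * N := by positivity
  set Y : ℝ := ε⁻¹ * N with hY
  have hYε : Y * ε = N := by rw [hY]; field_simp
  have hHle : Y * H ≤ Y * ((Real.log Mr + 3 / 20) * L) - Y * D := by
    rw [hH, mul_sub]
    have h := mul_le_mul_of_nonneg_left hV hNε.le
    linarith only [h]
  -- the diagonal times `L`
  have hLWd : L * (Y * (Real.log Mr + Real.log (25 / 4) - 1)) - L * (2.15 * N) ≤ L * Wd := by
    have h := mul_le_mul_of_nonneg_left hWd' hL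
    have e : L * (Y * (Real.log Mr + Real.log (25 / 4) - 1) - 2.15 * N) =
        L * (Y * (Real.log Mr + Real.log (25 / 4) - 1)) - L * (2.15 * N) := by ring
    rw [e] at h
    exact h
  -- collect: `ReQ ≥ Y D + c Y L − (64/25)E (N Mr) L − E(1 + (8/5)κ)(N A Q1) − 2.15 N L`
  have hcollect : Y * D + (Real.log (25 / 4) - 1 - 3 / 20) * (Y * L)
      - 64 / 25 * E * ((N * Mr) * L) - (E + 8 / 5 * E * κ) * (N * (A * Q1)) - 2.15 * (N * L) ≤ ReQ := by
    have e1 : 8 / 5 * E * N * (8 / 5 * Mr * L + 5 / 8 * (A * Q1)) =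
        64 / 25 * E * ((N * Mr) * L) + E * (N * (A * Q1)) := by ring
    have e2 : 8 / 5 * N * E * κ * A * Q1 = 8 / 5 * E * κ * (N * (A * Q1)) := by ring
    have e3 : Y * ((Real.log Mr + 3 / 20) * L) = Real.log Mr * (Y * L) + 3 / 20 * (Y * L) := by ring
    have e4 : L * (Y * (Real.log Mr + Real.log (25 / 4) - 1)) =
        Real.log Mr * (Y * L) + (Real.log (25 / 4) - 1) * (Y * L) := by ring
    have e5 : L * (2.15 * N) = 2.15 * (N * L) := by ring
    have e6 : (E + 8 / 5 * E * κ) * (N * (A * Q1)) =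
        E * (N * (A * Q1)) + 8 / 5 * E * κ * (N * (A * Q1)) := by ring
    rw [hQ, e6]
    rw [e1] at hP''
    rw [e2] at hOff'
    rw [e3] at hHle
    rw [e4, e5] at hLWd
    linarith only [hP'', hOff', hHle, hLWd]
  -- absolute forms of the small quantities: `N Mr ≤ Y/20`, `N ≤ Y/20`, `N A Q1 ≤ 6 (N Mr) D + (119/50)(N Mr) L`
  have hNMr : N * Mr ≤ Y / 20 := by
    have h := mul_le_mul_of_nonneg_left hlam hNε.le
    have e : Y * (ε * Mr) = N * Mr := by rw [← hYε]; ring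
    rw [e] at h
    linarith only [h]
  have hN40 : N ≤ Y / 20 := by
    have h := mul_le_mul_of_nonneg_left hε40 hNε.le
    rw [hYε] at h
    linarith only [h]
  have hNAQ : N * (A * Q1) ≤ 6 * ((N * Mr) * D) + 119 / 50 * ((N * Mr) * L) := by
    have hP10 := hPoinc 5 (by norm_num)
    have h1 : A * Q1 ≤ Qp + Mr * L := by rw [hA, add_comm]; exact hQ1le
    have h2 : A * Q1 ≤ 6 * Mr * D + 119 / 50 * Mr * L := by
      have e : (1 + 5) * Mr * D + (1 + 1 / 5) * (23 / 20) * Mr * L = 6 * Mr * D + 69 / 50 * Mr * L := by ring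
      rw [e] at hP10
      linarith only [h1, hP10]
    have h3 := mul_le_mul_of_nonneg_left h2 hN.le
    have e2 : N * (6 * Mr * D + 119 / 50 * Mr * L) = 6 * ((N * Mr) * D) + 119 / 50 * ((N * Mr) * L) := by ring
    rw [e2] at h3
    exact h3
  -- numeric coefficient bounds
  have hEk : E + 8 / 5 * E * κ ≤ 2.967 := by
    have : E * κ ≤ 1.0525 * 1.1364 := mul_le_mul hEle hκle hκpos.le (by norm_num)
    linarith only [this, hEle]
  have hEk0 : 0 ≤ E + 8 / 5 * E * κ := by positivity
  have hYD : 0 ≤ Y * D := mul_nonneg hNε.le hD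
  have hYL : 0 ≤ Y * L := mul_nonneg hNε.le hL
  have hNMrD : (N * Mr) * D ≤ Y / 20 * D := mul_le_mul_of_nonneg_right hNMr hD
  have hNMrL : (N * Mr) * L ≤ Y / 20 * L := mul_le_mul_of_nonneg_right hNMr hL
  have hNL : N * L ≤ Y / 20 * L := mul_le_mul_of_nonneg_right hN40 hL
  -- term 1: `(64/25)E (N Mr) L ≤ (64/25) · 1.0525 · (Y/20) L`
  have hT1 : 64 / 25 * E * ((N * Mr) * L) ≤ 64 / 25 * 1.0525 * (Y / 20 * L) := by
    have h0 : 0 ≤ (N * Mr) * L := by positivity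
    have := mul_le_mul hEle hNMrL h0 (by norm_num)
    linarith only [this]
  -- term 2: `E(1 + (8/5)κ)(N A Q1) ≤ 2.967 (6 (Y/20) D + (119/50) (Y/20) L)`
  have hT2 : (E + 8 / 5 * E * κ) * (N * (A * Q1)) ≤
      2.967 * (6 * (Y / 20 * D) + 119 / 50 * (Y / 20 * L)) := by
    have h1 : N * (A * Q1) ≤ 6 * (Y / 20 * D) + 119 / 50 * (Y / 20 * L) := by
      linarith only [hNAQ, hNMrD, hNMrL]
    calc (E + 8 / 5 * E * κ) * (N * (A * Q1)) ≤
        (E + 8 / 5 * E * κ) * (6 * (Y / 20 * D) + 119 / 50 * (Y / 20 * L)) :=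
          mul_le_mul_of_nonneg_left h1 hEk0
      _ ≤ 2.967 * (6 * (Y / 20 * D) + 119 / 50 * (Y / 20 * L)) :=
          mul_le_mul_of_nonneg_right hEk (by positivity)
  -- term 3 is `hNL`; the constant `c = log(25/4) − 1 − 3/20 ≥ 0.6818`
  have hc : (0.6818 : ℝ) * (Y * L) ≤ (Real.log (25 / 4) - 1 - 3 / 20) * (Y * L) := by
    apply mul_le_mul_of_nonneg_right _ hYL
    linarith only [hlog254]
  have eYD : Y / 20 * D = (1 / 20) * (Y * D) := by ring
  have eYL : Y / 20 * L = (1 / 20) * (Y * L) := by ring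
  rw [eYD, eYL] at hT2
  rw [eYL] at hT1 hNL
  linarith only [hcollect, hT1, hT2, hNL, hc, hYD, hYL]

end Summit.RiemannHypothesis.RiemannHypothesis.Theorems.WeilCombBohrFejer

end
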